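import Mathlib
import Summits.ValiantsHypothesis.ValiantsHypothesis.Theorems.LacunarySymmetroidMatrixDescartesDefiniteMomentsZonesLocal

/-!
# `MatrixDescartes` (stmt-ValiantsHypothesis-18050) — the DEFINITE-MOMENTS LAW, zones V: root counts near a vector
# (stable at non-roots, controlled at roots) and gap bookkeeping

HONEST FRAMING.  Cell `pub-symmetroid`, seat `val-sym-mdr-p2` (gen 15); helper file `--supports` the crux
`Theses.LacunarySymmetroid.MatrixDescartes`, NO closure claim.  Bookkeeping for the planar step of the lacunary Markus
theorem; nothing here bears on the crux in its window, on `stub_twoSided`, on `DoorA26`/`DoorA34`, registers, or `VP ≠ VNP`.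

CONTENT.  Rayleigh-sharp pencil, `N(x, u) = #{roots of P_u in (0, x)}`, `N⁺(x, u) = #{roots of P_u in (0, x]}`.
* §1 gap bookkeeping for one real polynomial (`N ≤ N⁺ ≤ N + 1`, `N⁺ = N` at a non-root, `N⁺ = N + 1` at a root, moving the
  threshold across a root-free gap, root-free gaps just above / below a point);
* §2 `count_stable_of_nonroot`: if `x > 0` is not a root of `P_v` then `N(x, v') = N(x, v)` and `x` is not a root of
  `P_{v'}` for all `v'` near `v`;  `count_near_root`: if `x` is a root of `P_v` then for `v'` near `v`,
  `N(x, v) ≤ N(x, v') ≤ N⁺(x, v') ≤ N(x, v) + 1`, and `N(x, v') = N(x, v)` whenever `x` is still a root of `P_{v'}` (both from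
  `locRoots`). [folklore]; axioms `propext`, `Classical.choice`, `Quot.sound`; no definitions.
-/

-- layout Summits/ValiantsHypothesis/ValiantsHypothesis forces the duplicated namespace component
set_option linter.dupNamespace false

namespace Summit.ValiantsHypothesis.ValiantsHypothesis.Theorems.LacunarySymmetroidMatrixDescartes

open Polynomial Matrix Finset
open scoped BigOperators Topology

namespace DefiniteMoments

/-! ## §1 Gap bookkeeping for one polynomial -/

section Gaps

/-- `N(x) ≤ N⁺(x)`. [folklore] -/
theorem rootsBelow_le_rootsUpTo (P : ℝ[X]) (x : ℝ) :
    (P.roots.toFinset.filter (fun t => 0 < t ∧ t < x)).card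
      ≤ (P.roots.toFinset.filter (fun t => 0 < t ∧ t ≤ x)).card :=
  Finset.card_le_card (Finset.monotone_filter_right _ fun _ _ ht => ⟨ht.1, ht.2.le⟩)

/-- `N⁺(x) ≤ N(x) + 1`. [folklore] -/
theorem rootsUpTo_le_succ (P : ℝ[X]) (x : ℝ) :
    (P.roots.toFinset.filter (fun t => 0 < t ∧ t ≤ x)).card
      ≤ (P.roots.toFinset.filter (fun t => 0 < t ∧ t < x)).card + 1 := by
  classical
  have hsub : P.roots.toFinset.filter (fun t => 0 < t ∧ t ≤ x)
      ⊆ insert x (P.roots.toFinset.filter (fun t => 0 < t ∧ t < x)) := by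
    intro t ht
    rw [Finset.mem_insert, Finset.mem_filter]
    rw [Finset.mem_filter] at ht
    rcases ht.2.2.lt_or_eq with h | h
    · exact Or.inr ⟨ht.1, ht.2.1, h⟩
    · exact Or.inl h
  exact (Finset.card_le_card hsub).trans (Finset.card_insert_le _ _)

/-- At a non-root, `N⁺(x) = N(x)`. [folklore] -/
theorem rootsUpTo_eq_rootsBelow_of_nonroot (P : ℝ[X]) (hP : P ≠ 0) {x : ℝ} (hx : ¬ P.IsRoot x) :
    (P.roots.toFinset.filter (fun t => 0 < t ∧ t ≤ x)).card
      = (P.roots.toFinset.filter (fun t => 0 < t ∧ t < x)).card := by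
  congr 1
  ext t
  rw [Finset.mem_filter, Finset.mem_filter, Multiset.mem_toFinset, mem_roots hP]
  constructor
  · rintro ⟨h1, h2, h3⟩
    refine ⟨h1, h2, lt_of_le_of_ne h3 ?_⟩
    rintro rfl; exact hx h1
  · rintro ⟨h1, h2, h3⟩; exact ⟨h1, h2, h3.le⟩

/-- At a positive root, `N⁺(x) = N(x) + 1`. [folklore] -/
theorem rootsUpTo_eq_succ_of_root (P : ℝ[X]) (hP : P ≠ 0) {x : ℝ} (hx0 : 0 < x) (hx : P.IsRoot x) :
    (P.roots.toFinset.filter (fun t => 0 < t ∧ t ≤ x)).card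
      = (P.roots.toFinset.filter (fun t => 0 < t ∧ t < x)).card + 1 := by
  classical
  have heq : P.roots.toFinset.filter (fun t => 0 < t ∧ t ≤ x)
      = insert x (P.roots.toFinset.filter (fun t => 0 < t ∧ t < x)) := by
    ext t
    rw [Finset.mem_insert, Finset.mem_filter, Finset.mem_filter, Multiset.mem_toFinset, mem_roots hP]
    constructor
    · rintro ⟨h1, h2, h3⟩
      rcases h3.lt_or_eq with h | h
      · exact Or.inr ⟨h1, h2, h⟩
      · exact Or.inl h
    · rintro (rfl | ⟨h1, h2, h3⟩)
      · exact ⟨hx, hx0, le_rfl⟩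
      · exact ⟨h1, h2, h3.le⟩
  have hnot : x ∉ P.roots.toFinset.filter (fun t => 0 < t ∧ t < x) := by
    intro h; rw [Finset.mem_filter] at h; exact lt_irrefl x h.2.2
  rw [heq, Finset.card_insert_of_notMem hnot]

/-- Moving the threshold across a root-free gap `(x, x')`: `N(x') = N⁺(x)`. [folklore] -/
theorem rootsBelow_eq_rootsUpTo_of_gap (P : ℝ[X]) (hP : P ≠ 0) {x x' : ℝ} (hxx' : x < x')
    (hgap : ∀ t : ℝ, P.IsRoot t → ¬ (x < t ∧ t < x')) :
    (P.roots.toFinset.filter (fun t => 0 < t ∧ t < x')).card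
      = (P.roots.toFinset.filter (fun t => 0 < t ∧ t ≤ x)).card := by
  congr 1
  ext t
  rw [Finset.mem_filter, Finset.mem_filter, Multiset.mem_toFinset, mem_roots hP]
  constructor
  · rintro ⟨h1, h2, h3⟩
    refine ⟨h1, h2, ?_⟩
    by_contra hlt
    push Not at hlt
    exact hgap t h1 ⟨hlt, h3⟩
  · rintro ⟨h1, h2, h3⟩; exact ⟨h1, h2, h3.trans_lt hxx'⟩

/-- A root-free gap just above a point, for finitely many root sets at once: some `x' > x` with no element of `R` in
`(x, x']`. [folklore] -/
theorem exists_gap_above (R : Finset ℝ) (x : ℝ) : ∃ x' : ℝ, x < x' ∧ ∀ t ∈ R, ¬ (x < t ∧ t ≤ x') := by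
  by_cases hG : (R.filter (fun t => x < t)).Nonempty
  · set m := (R.filter (fun t => x < t)).min' hG with hm
    have hmx : x < m := (Finset.mem_filter.1 ((R.filter (fun t => x < t)).min'_mem hG)).2
    refine ⟨(x + m) / 2, by linarith, fun t ht h => ?_⟩
    have := (R.filter (fun t => x < t)).min'_le t (Finset.mem_filter.2 ⟨ht, h.1⟩)
    rw [← hm] at this
    linarith [h.2]
  · refine ⟨x + 1, by linarith, fun t ht h => hG ⟨t, Finset.mem_filter.2 ⟨ht, h.1⟩⟩⟩

/-- A root-free gap just below a positive point: some `0 < x' < x` with no element of `R` in `[x', x)`. [folklore] -/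
theorem exists_gap_below (R : Finset ℝ) {x : ℝ} (hx : 0 < x) :
    ∃ x' : ℝ, 0 < x' ∧ x' < x ∧ ∀ t ∈ R, ¬ (x' ≤ t ∧ t < x) := by
  by_cases hG : (R.filter (fun t => t < x)).Nonempty
  · set m := (R.filter (fun t => t < x)).max' hG with hm
    have hmx : m < x := (Finset.mem_filter.1 ((R.filter (fun t => t < x)).max'_mem hG)).2
    refine ⟨max ((x + m) / 2) (x / 2), lt_max_of_lt_right (by linarith), max_lt (by linarith) (by linarith),
      fun t ht h => ?_⟩
    have := (R.filter (fun t => t < x)).le_max' t (Finset.mem_filter.2 ⟨ht, h.2⟩)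
    rw [← hm] at this
    have h1 := h.1
    have : (x + m) / 2 ≤ max ((x + m) / 2) (x / 2) := le_max_left _ _
    linarith
  · refine ⟨x / 2, by linarith, by linarith, fun t ht h => hG ⟨t, Finset.mem_filter.2 ⟨ht, h.2⟩⟩⟩

end Gaps

/-! ## §2 Root counts near a vector -/

section Nearby

variable {ι : Type} [Fintype ι]

/-- A polynomial with an element in its positive root set is non-zero. [folklore] -/
theorem ne_zero_of_mem_posRoots (P : ℝ[X]) {x : ℝ} (hx : x ∈ P.roots.toFinset.filter (fun t => 0 < t)) : P ≠ 0 := by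
  intro h
  rw [h, Polynomial.roots_zero, Multiset.toFinset_zero, Finset.filter_empty] at hx
  exact Finset.notMem_empty x hx

/-- **Stable count at a non-root.**  Rayleigh-sharp pencil, `v ≠ 0`, `x > 0` with `vᵀF(x)v ≠ 0`: for all `v'` near `v`,
`N(x, v') = N(x, v)` and `v'ᵀF(x)v' ≠ 0`. [folklore] -/
theorem count_stable_of_nonroot {K : ℕ} (hK : 2 ≤ K) (d : Fin K → ℕ) (S : Fin K → Matrix ι ι ℝ)
    (hsharp : ∀ v : ι → ℝ, v ≠ 0 →
      K ≤ ((∑ l, C (v ⬝ᵥ (S l *ᵥ v)) * (X : ℝ[X]) ^ d l).roots.toFinset.filter (fun t => 0 < t)).card + 1)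
    (v : ι → ℝ) (hv : v ≠ 0) {x : ℝ} (hx : 0 < x) (hvx : v ⬝ᵥ ((∑ k, x ^ d k • S k) *ᵥ v) ≠ 0) :
    ∃ η : ℝ, 0 < η ∧ ∀ v' : ι → ℝ, dist v' v < η →
      ((∑ l, C (v' ⬝ᵥ (S l *ᵥ v')) * (X : ℝ[X]) ^ d l).roots.toFinset.filter (fun t => 0 < t ∧ t < x)).card
        = ((∑ l, C (v ⬝ᵥ (S l *ᵥ v)) * (X : ℝ[X]) ^ d l).roots.toFinset.filter (fun t => 0 < t ∧ t < x)).card ∧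
      v' ⬝ᵥ ((∑ k, x ^ d k • S k) *ᵥ v') ≠ 0 := by
  classical
  obtain ⟨r, hr, hrT⟩ := exists_enum_posRoots hK d S hsharp v hv
  have hPv0 := rayleighPoly_ne_zero_of_sharp hK d S hsharp v hv
  have hr0 : ∀ i, 0 < r i := fun i =>
    ((mem_posRoots_iff d S v hPv0 (r i)).1 ((hrT (r i)).2 ⟨i, rfl⟩)).1
  have hxr : ∀ i, r i ≠ x := by
    intro i h
    have hmem := (hrT (r i)).2 ⟨i, rfl⟩
    rw [h, mem_posRoots_iff d S v hPv0 x] at hmem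
    exact hvx hmem.2
  set E : Finset ℝ := Finset.univ.image (fun i => |x - r i|) with hE
  have hEpos : ∀ e ∈ E, 0 < e := by
    intro e he
    obtain ⟨i, -, rfl⟩ := Finset.mem_image.1 he
    exact abs_pos.2 (sub_ne_zero.2 (Ne.symm (hxr i)))
  obtain ⟨δ, hδ, hδ0, hsep, hδE⟩ := exists_window_radius r hr hr0 E hEpos
  have hfar : ∀ i, r i + δ ≤ x ∨ x ≤ r i - δ := by
    intro i
    have h := hδE (|x - r i|) (Finset.mem_image.2 ⟨i, Finset.mem_univ _, rfl⟩)
    rcases lt_or_gt_of_ne (hxr i) with hlt | hgt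
    · left; rw [abs_of_pos (sub_pos.2 hlt)] at h; linarith
    · right; rw [abs_of_neg (sub_neg.2 hgt)] at h; linarith
  obtain ⟨η, hη, hloc⟩ := locRoots hK d S hsharp v hv r hr hrT hδ hδ0 hsep
  refine ⟨η, hη, fun v' hv' => ?_⟩
  obtain ⟨z, hz, hzT⟩ := hloc v' hv'
  have hzinj := injective_of_windows r z δ hsep hz
  obtain ⟨hcount, hzx⟩ := count_eq_of_far r z δ hz x hfar
  refine ⟨?_, ?_⟩
  · rw [rootsBelow_enum d S v' z hzinj hzT x, hcount, rootsBelow_enum d S v r hr.injective hrT x]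
  · intro h0
    have i₀ : Fin (K - 1) := ⟨0, by omega⟩
    have hPw0 := ne_zero_of_mem_posRoots _ ((hzT (z i₀)).2 ⟨i₀, rfl⟩)
    obtain ⟨i, hi⟩ := (hzT x).1 ((mem_posRoots_iff d S v' hPw0 x).2 ⟨hx, h0⟩)
    exact hzx i hi

/-- **Controlled count at a root.**  Rayleigh-sharp pencil, `v ≠ 0`, `x > 0` with `vᵀF(x)v = 0`: for all `v'` near `v`,
`N(x, v) ≤ N(x, v') ≤ N⁺(x, v') ≤ N(x, v) + 1`, and `N(x, v') = N(x, v)` if `v'ᵀF(x)v' = 0` as well. [folklore] -/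
theorem count_near_root {K : ℕ} (hK : 2 ≤ K) (d : Fin K → ℕ) (S : Fin K → Matrix ι ι ℝ)
    (hsharp : ∀ v : ι → ℝ, v ≠ 0 →
      K ≤ ((∑ l, C (v ⬝ᵥ (S l *ᵥ v)) * (X : ℝ[X]) ^ d l).roots.toFinset.filter (fun t => 0 < t)).card + 1)
    (v : ι → ℝ) (hv : v ≠ 0) {x : ℝ} (hx : 0 < x) (hvx : v ⬝ᵥ ((∑ k, x ^ d k • S k) *ᵥ v) = 0) :
    ∃ η : ℝ, 0 < η ∧ ∀ v' : ι → ℝ, dist v' v < η →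
      ((∑ l, C (v ⬝ᵥ (S l *ᵥ v)) * (X : ℝ[X]) ^ d l).roots.toFinset.filter (fun t => 0 < t ∧ t < x)).card
        ≤ ((∑ l, C (v' ⬝ᵥ (S l *ᵥ v')) * (X : ℝ[X]) ^ d l).roots.toFinset.filter (fun t => 0 < t ∧ t < x)).card ∧
      ((∑ l, C (v' ⬝ᵥ (S l *ᵥ v')) * (X : ℝ[X]) ^ d l).roots.toFinset.filter (fun t => 0 < t ∧ t ≤ x)).card
        ≤ ((∑ l, C (v ⬝ᵥ (S l *ᵥ v)) * (X : ℝ[X]) ^ d l).roots.toFinset.filter (fun t => 0 < t ∧ t < x)).card + 1 ∧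
      (v' ⬝ᵥ ((∑ k, x ^ d k • S k) *ᵥ v') = 0 →
        ((∑ l, C (v' ⬝ᵥ (S l *ᵥ v')) * (X : ℝ[X]) ^ d l).roots.toFinset.filter (fun t => 0 < t ∧ t < x)).card
          = ((∑ l, C (v ⬝ᵥ (S l *ᵥ v)) * (X : ℝ[X]) ^ d l).roots.toFinset.filter (fun t => 0 < t ∧ t < x)).card) := by
  classical
  obtain ⟨r, hr, hrT⟩ := exists_enum_posRoots hK d S hsharp v hv
  have hPv0 := rayleighPoly_ne_zero_of_sharp hK d S hsharp v hv
  have hr0 : ∀ i, 0 < r i := fun i =>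
    ((mem_posRoots_iff d S v hPv0 (r i)).1 ((hrT (r i)).2 ⟨i, rfl⟩)).1
  obtain ⟨i₀, hi₀⟩ := (hrT x).1 ((mem_posRoots_iff d S v hPv0 x).2 ⟨hx, hvx⟩)
  obtain ⟨δ, hδ, hδ0, hsep, -⟩ := exists_window_radius r hr hr0 ∅ (fun e he => absurd he (Finset.notMem_empty e))
  obtain ⟨η, hη, hloc⟩ := locRoots hK d S hsharp v hv r hr hrT hδ hδ0 hsep
  refine ⟨η, hη, fun v' hv' => ?_⟩
  obtain ⟨z, hz, hzT⟩ := hloc v' hv'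
  have hzinj := injective_of_windows r z δ hsep hz
  rw [← hi₀, rootsBelow_enum d S v r hr.injective hrT (r i₀), rootsBelow_enum d S v' z hzinj hzT (r i₀),
    rootsUpTo_enum d S v' z hzinj hzT (r i₀)]
  refine ⟨count_at_root_lower r z hr δ hδ hsep hz i₀, count_at_root_upper r z hr δ hδ hsep hz i₀, fun h0 => ?_⟩
  have hPw0 := ne_zero_of_mem_posRoots _ ((hzT (z i₀)).2 ⟨i₀, rfl⟩)
  have hmem := (hzT (r i₀)).1 ((mem_posRoots_iff d S v' hPw0 (r i₀)).2 ⟨hr0 i₀, h0⟩)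
  exact count_at_common_root r z hr δ hδ hsep hz i₀ hmem

end Nearby

end DefiniteMoments

end Summit.ValiantsHypothesis.ValiantsHypothesis.Theorems.LacunarySymmetroidMatrixDescartes
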